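import Summits.KontsevichZagierPeriods.KontsevichZagierPeriods.Theorems.LinRedNormalFormArrangementNormalFormStubRebaseSimplePosOneFibreAssembly

/-!
# Stub `stub_rebaseSimplePosOne` (crux `ArrangementNormalForm`, line `janus-bands`, v6.2) —
part `Thick`: thick bands above the letter

The bounded-below regimes of the two residual hypotheses `Hthick` / `Hfar` of
`RebasePos.good_above_of_residual` (one lettered fibre over a base of dimension `B + 1`, letter
sheared to `0`, transverse non-parallel bounds `u < v`, apex level `κ` with `u − κ = A (v − u)`,
`A > 0`), uniformly in the silent base coordinates `x'`:
* `RebasePos.good_thickBand` — ANY band `0 < u < v` above the letter whose thickness `v − u` is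
  bounded below on the base cell by a constant `c₀ > 0` is congruent to the subgroup generated by
  `GG B 2 1`: Janus extension of the upper bound up to a CONSTANT level `K ≥ sup v` (rule 1a,
  `RebasePos.janusExtendHi`); the upper wedge `{v < t < K}` is dominated
  (`RebasePos.integrableOn_wedge_hi` with `λ = c₁/(2K)`, `c₁ ≤ c₀` rational); both pieces have the
  `y`-free upper bound `K` (product case, rule 2). Registered as `rebaseSimplePos_thickBand`.
* `RebasePos.good_thick_of_apexNeg` — `Hthick` on base cells where the apex level stays below
  `−c₀ < 0` (then `v − u = (u − κ)/A > c₀/A`). Registered as `rebaseSimplePos_thick_of_apexNeg`.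
* `RebasePos.good_far_of_apexPos` — `Hfar` on base cells where the apex level stays above
  `c₀ > 0` (then `v − u = (v − κ)/(A + 1) ≥ κ/(A + 1) ≥ c₀/(A + 1)`). Registered as
  `rebaseSimplePos_far_of_apexPos`.
What is NOT covered (the residue of both hypotheses): THIN bands, `v − u → 0` on the closure of
the base cell; since `v − u ≥ |κ|/A` (thick case) resp. `≥ κ/(A + 1)` (far case) this forces
`κ → 0` as well: the apex of the band touches the letter at a boundary point of the base cell
(part `Corner`).

References: M. Kontsevich, D. Zagier, *Periods* (2001), §1.2, rules (1a), (2).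
-/

noncomputable section

open Set MeasureTheory MvPolynomial
open Literature.NumberTheory.Transcendental Literature.ModelTheory.ExponentialFields

namespace Summit.KontsevichZagierPeriods.ArrangementNormalForm.JanusBands

namespace RebasePos

open SeparatePos

section Thick

variable {B m m' : ℕ}

/-- **Base coordinates are bounded on the base cell of a bounded non-degenerate band**: if
`{rows, θ < t < θ'}` is bounded and `θ < θ'` on the base cell, every point of the base cell has
base coordinates bounded by the radius of the band. -/
theorem exists_base_abs_le (M : Fin m' → (Fin (B + 1) → ℚ) × ℚ) (θ θ' : (Fin (B + 1) → ℚ) × ℚ)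
    (hbd : Bornology.IsBounded (gDom B 1 m' M (fun _ => Sum.inr θ) (fun _ => Sum.inr θ')))
    (hne : ∀ z : Fin (B + 1 + 1) → ℝ, (∀ j, 0 < affF B 1 (M j) z) → affF B 1 θ z < affF B 1 θ' z) :
    ∃ R : ℝ, 0 < R ∧ ∀ z : Fin (B + 1 + 1) → ℝ, (∀ j, 0 < affF B 1 (M j) z) →
      ∀ j : Fin (B + 1), |z (Fin.castAdd 1 j)| ≤ R := by
  obtain ⟨R, hR0, hR⟩ := hbd.exists_pos_norm_le
  refine ⟨R, hR0, fun z hrow j => ?_⟩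
  set z' : Fin (B + 1 + 1) → ℝ :=
    Function.update z (Fin.natAdd (B + 1) 0) ((affF B 1 θ z + affF B 1 θ' z) / 2) with hz'
  have hbase : ∀ j : Fin (B + 1), z' (Fin.castAdd 1 j) = z (Fin.castAdd 1 j) := fun j => by
    rw [hz', Function.update_of_ne]
    intro h
    have := congrArg Fin.val h
    simp at this
    omega
  have haff : ∀ d, affF B 1 d z' = affF B 1 d z := fun d => by simp [affF, hbase]
  have hz'D : z' ∈ gDom B 1 m' M (fun _ => Sum.inr θ) (fun _ => Sum.inr θ') := by
    rw [mem_gDom_one]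
    simp only [haff]
    have hlt := hne z hrow
    refine ⟨hrow, ?_, ?_⟩ <;> rw [hz', Function.update_self] <;> linarith
  have h := norm_le_pi_norm z' (Fin.castAdd 1 j)
  rw [Real.norm_eq_abs, hbase] at h
  exact h.trans (hR z' hz'D)

/-- A constant level `K` of the base: a `y`-free form with constant value. -/
theorem exists_const_level (K₀ : ℚ) : ∃ K : (Fin (B + 1) → ℚ) × ℚ, K.1 (Fin.last B) = 0 ∧
    ∀ z : Fin (B + 1 + 1) → ℝ, affF B 1 K z = K₀ :=
  ⟨((0 : Fin (B + 1) → ℚ), K₀), rfl, fun z => affF_const K₀ z⟩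

variable (L : Fin m → (Fin B → ℚ) × ℚ) (e : Fin m → ℕ) (ℓ₁ ℓ₂ : (Fin B → ℚ) × ℚ) (n₁ n₂ : ℕ)

/-- **A thick band above its letter.** One lettered fibre with letter `0` and affine bounds
`0 < u < v` on the base cell whose thickness is bounded below there, `u + c₀ ≤ v` for a constant
`c₀ > 0`: `[s]` is congruent modulo `KZ.relations` to the subgroup generated by `GG B 2 1`.
Janus extension of the upper bound up to a constant level `K ≥ sup v` (rule 1a); the upper wedge
`{v < t < K}` is dominated (`integrableOn_wedge_hi` with `λ (K − v) ≤ 2 λ K = c₁ < c₀ ≤ v − u`);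
both pieces `{u < t < K}`, `{v < t < K}` have the `y`-free upper bound `K` (product case). -/
theorem good_thickBand (s : KZ.IntegralRep (B + 1 + 1)) (M : Fin m' → (Fin (B + 1) → ℚ) × ℚ)
    (p : MvPolynomial (Fin B) ℚ) (u v : (Fin (B + 1) → ℚ) × ℚ) (c₀ : ℝ) (h12 : n₁ = 0 ∨ n₂ = 0)
    (hbd : Bornology.IsBounded s.domain)
    (hdom : s.domain = gDom B 1 m' M (fun _ => Sum.inr u) (fun _ => Sum.inr v))
    (hint : EqOn s.integrand (glit B 1 p L e ℓ₁ ℓ₂ n₁ n₂ (fun _ => some 0)) s.domain)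
    (hc₀ : 0 < c₀)
    (hcell : ∀ z : Fin (B + 1 + 1) → ℝ, (∀ j, 0 < affF B 1 (M j) z) →
      0 < affF B 1 u z ∧ affF B 1 u z + c₀ ≤ affF B 1 v z) :
    ∃ c ∈ AddSubgroup.closure (GGset B 2 1), KZ.of s - c ∈ KZ.relations := by
  have hlt : ∀ z : Fin (B + 1 + 1) → ℝ, (∀ j, 0 < affF B 1 (M j) z) → affF B 1 u z < affF B 1 v z :=
    fun z hz => by linarith [(hcell z hz).2]
  -- a constant level above the band
  obtain ⟨R, hR0, hR⟩ := exists_base_abs_le M u v (hdom ▸ hbd) hlt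
  set V : ℝ := (∑ j, |(v.1 j : ℝ)|) * R + |(v.2 : ℝ)| with hV
  have hvle : ∀ z : Fin (B + 1 + 1) → ℝ, (∀ j, 0 < affF B 1 (M j) z) → |affF B 1 v z| ≤ V :=
    fun z hz => abs_affF_le v (hR z hz)
  obtain ⟨K₀, hK₀⟩ := exists_rat_gt V
  have hV0 : 0 ≤ V := by rw [hV]; positivity
  have hK₀pos : (0 : ℝ) < K₀ := lt_of_le_of_lt hV0 hK₀
  have hK₀pos' : (0 : ℚ) < K₀ := by exact_mod_cast hK₀pos
  obtain ⟨K, hK1, hK⟩ := exists_const_level (B := B) K₀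
  -- a rational thickness
  obtain ⟨c₁, hc₁0, hc₁⟩ := exists_rat_btwn hc₀
  have hc₁0' : (0 : ℚ) < c₁ := by exact_mod_cast hc₁0
  set lam : ℚ := c₁ / (2 * K₀) with hlam
  have hlam0 : 0 < lam := div_pos hc₁0' (by positivity)
  have hlamK : (lam : ℝ) * (2 * K₀) = c₁ := by
    rw [hlam]
    push_cast
    field_simp
  have hvK : ∀ z : Fin (B + 1 + 1) → ℝ, (∀ j, 0 < affF B 1 (M j) z) → affF B 1 v z ≤ affF B 1 K z :=
    fun z hz => by
      rw [hK]
      exact (le_abs_self _).trans ((hvle z hz).trans hK₀.le)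
  -- the upper wedge converges
  have hWint : IntegrableOn (glit B 1 p L e ℓ₁ ℓ₂ n₁ n₂ (fun _ => some 0))
      (gDom B 1 m' M (fun _ => Sum.inr v) (fun _ => Sum.inr K)) :=
    integrableOn_wedge_hi s M p L e ℓ₁ ℓ₂ n₁ n₂ 0 u v K hdom hint lam hlam0 fun z hz => by
      obtain ⟨hu0, huv⟩ := hcell z hz
      refine ⟨by rwa [affF_zero''], hvK z hz, ?_⟩
      have h1 : affF B 1 K z - affF B 1 v z ≤ 2 * K₀ := by
        rw [hK]
        linarith [neg_abs_le (affF B 1 v z), hvle z hz]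
      have h2 : (lam : ℝ) * (affF B 1 K z - affF B 1 v z) ≤ (lam : ℝ) * (2 * K₀) :=
        mul_le_mul_of_nonneg_left h1 (by exact_mod_cast hlam0.le)
      linarith
  -- Janus extension of the upper bound
  obtain ⟨sT, sW, hdT, hiT, hbdT, hdW, hiW, hbdW, hrel⟩ := janusExtendHi s M (fun _ => Sum.inr u)
    (fun _ => Sum.inr v) hdom L e p ℓ₁ ℓ₂ n₁ n₂ (fun _ => some 0) hint 0 v K rfl hvK
    (fun z hz => le_of_lt (hlt z hz.1)) (by rw [update_fin_one, update_fin_one]; exact hWint)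
    (by rw [update_fin_one]; exact isBounded_gDom_one M u v u K (hdom ▸ hbd) hlt)
  rw [update_fin_one] at hdT hdW
  rw [update_fin_one] at hdW
  have hK0 : ∀ c : (Fin (B + 1) → ℚ) × ℚ, some (0 : (Fin (B + 1) → ℚ) × ℚ) = some c →
      K.1 (Fin.last B) = c.1 (Fin.last B) := fun c hc => by cases hc; simpa using hK1
  refine good_of_janus hrel ?_ ?_
  · exact good_product (fun _ => some 0) (fun _ => u) (fun _ => K) sT M L e p ℓ₁ ℓ₂
      (fun _ => Sum.inr u) (fun _ => Sum.inr K) h12 hbdT hdT (by rw [hiT]; exact fun _ _ => rfl)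
      (fun _ => rfl) (fun _ => rfl) fun _ c hc => Or.inr (hK0 c hc)
  · exact good_product (fun _ => some 0) (fun _ => v) (fun _ => K) sW M L e p ℓ₁ ℓ₂
      (fun _ => Sum.inr v) (fun _ => Sum.inr K) h12 hbdW hdW (by rw [hiW]; exact fun _ _ => rfl)
      (fun _ => rfl) (fun _ => rfl) fun _ c hc => Or.inr (hK0 c hc)

/-- **`Hthick` away from the letter** (band above its apex level `κ`, apex level below `−c₀ < 0`
on the base cell): with `u − κ = A (v − u)`, `A > 0` and `u > 0`, the thickness is
`v − u = (u − κ)/A > c₀/A`, so `good_thickBand` applies. -/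
theorem good_thick_of_apexNeg (s : KZ.IntegralRep (B + 1 + 1)) (M : Fin m' → (Fin (B + 1) → ℚ) × ℚ)
    (p : MvPolynomial (Fin B) ℚ) (u v κ : (Fin (B + 1) → ℚ) × ℚ) (A : ℚ) (c₀ : ℝ)
    (h12 : n₁ = 0 ∨ n₂ = 0) (hbd : Bornology.IsBounded s.domain)
    (hdom : s.domain = gDom B 1 m' M (fun _ => Sum.inr u) (fun _ => Sum.inr v))
    (hint : EqOn s.integrand (glit B 1 p L e ℓ₁ ℓ₂ n₁ n₂ (fun _ => some 0)) s.domain)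
    (hA : u - κ = A • (v - u)) (hA0 : 0 < A) (hc₀ : 0 < c₀)
    (hcell : ∀ z : Fin (B + 1 + 1) → ℝ, (∀ j, 0 < affF B 1 (M j) z) →
      affF B 1 κ z ≤ -c₀ ∧ 0 < affF B 1 u z) :
    ∃ c ∈ AddSubgroup.closure (GGset B 2 1), KZ.of s - c ∈ KZ.relations := by
  have huκ : ∀ z : Fin (B + 1 + 1) → ℝ, affF B 1 u z - affF B 1 κ z =
      (A : ℝ) * (affF B 1 v z - affF B 1 u z) := fun z => by
    have key := congrArg (fun q => affF B 1 q z) hA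
    simp only [affF_sub'', affF_smul'] at key
    exact key
  have hA0' : (0 : ℝ) < A := by exact_mod_cast hA0
  refine good_thickBand L e ℓ₁ ℓ₂ n₁ n₂ s M p u v (c₀ / A) h12 hbd hdom hint (div_pos hc₀ hA0')
    fun z hz => ?_
  obtain ⟨hκ, hu⟩ := hcell z hz
  refine ⟨hu, ?_⟩
  have h1 : c₀ ≤ (A : ℝ) * (affF B 1 v z - affF B 1 u z) := by rw [← huκ z]; linarith
  have h2 : c₀ / A ≤ affF B 1 v z - affF B 1 u z := by
    rw [div_le_iff₀ hA0']
    linarith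
  linarith

/-- **`Hfar` away from the letter** (band above its apex level `κ`, far regime `v ≥ 2κ`, apex
level above `c₀ > 0` on the base cell): with `u − κ = A (v − u)`, `A > 0`, the thickness is
`v − u = (v − κ)/(A + 1) ≥ κ/(A + 1) ≥ c₀/(A + 1)` and `u = κ + A (v − u) > 0`, so
`good_thickBand` applies. -/
theorem good_far_of_apexPos (s : KZ.IntegralRep (B + 1 + 1)) (M : Fin m' → (Fin (B + 1) → ℚ) × ℚ)
    (p : MvPolynomial (Fin B) ℚ) (u v κ : (Fin (B + 1) → ℚ) × ℚ) (A : ℚ) (c₀ : ℝ)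
    (h12 : n₁ = 0 ∨ n₂ = 0) (hbd : Bornology.IsBounded s.domain)
    (hdom : s.domain = gDom B 1 m' M (fun _ => Sum.inr u) (fun _ => Sum.inr v))
    (hint : EqOn s.integrand (glit B 1 p L e ℓ₁ ℓ₂ n₁ n₂ (fun _ => some 0)) s.domain)
    (hA : u - κ = A • (v - u)) (hA0 : 0 < A) (hc₀ : 0 < c₀)
    (hcell : ∀ z : Fin (B + 1 + 1) → ℝ, (∀ j, 0 < affF B 1 (M j) z) →
      c₀ ≤ affF B 1 κ z ∧ 2 * affF B 1 κ z ≤ affF B 1 v z) :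
    ∃ c ∈ AddSubgroup.closure (GGset B 2 1), KZ.of s - c ∈ KZ.relations := by
  have huκ : ∀ z : Fin (B + 1 + 1) → ℝ, affF B 1 u z - affF B 1 κ z =
      (A : ℝ) * (affF B 1 v z - affF B 1 u z) := fun z => by
    have key := congrArg (fun q => affF B 1 q z) hA
    simp only [affF_sub'', affF_smul'] at key
    exact key
  have hA0' : (0 : ℝ) < A := by exact_mod_cast hA0
  have hA1 : (0 : ℝ) < A + 1 := by linarith
  refine good_thickBand L e ℓ₁ ℓ₂ n₁ n₂ s M p u v (c₀ / (A + 1)) h12 hbd hdom hint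
    (div_pos hc₀ hA1) fun z hz => ?_
  obtain ⟨hκ, hfar⟩ := hcell z hz
  -- `v − κ = (A + 1)(v − u) ≥ κ ≥ c₀`
  have h1 : affF B 1 v z - affF B 1 κ z = ((A : ℝ) + 1) * (affF B 1 v z - affF B 1 u z) := by
    linarith [huκ z]
  have h2 : c₀ ≤ ((A : ℝ) + 1) * (affF B 1 v z - affF B 1 u z) := by rw [← h1]; linarith
  have h3 : c₀ / (A + 1) ≤ affF B 1 v z - affF B 1 u z := by
    rw [div_le_iff₀ hA1]
    linarith
  have h4 : 0 < affF B 1 v z - affF B 1 u z := lt_of_lt_of_le (div_pos hc₀ hA1) h3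
  refine ⟨?_, by linarith⟩
  nlinarith [huκ z]

end Thick

end RebasePos

/-- **Registered part of `stub_rebaseSimplePosOne` (line `janus-bands`, v6.2): a thick band
above its letter.** One lettered fibre over a base of dimension `B + 1` with letter `0`, affine
bounds `0 < u < v` on the base cell and thickness bounded below there (`u + c₀ ≤ v`, `c₀ > 0` a
constant), exponents `n₁ n₂` with `n₁ = 0 ∨ n₂ = 0`: `[s]` is congruent modulo `KZ.relations`
to the subgroup generated by the literal class `GG B 2 1` (`RebasePos.good_thickBand`: Janus
extension of the upper bound to a constant level with a dominated wedge, rule 1a, then two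
per-fibre affine pull-backs, rule 2; uniformly in the silent base coordinates). Both
bounded-below regimes of the residual hypotheses `Hthick` (`κ ≤ −c₀`) and `Hfar` (`κ ≥ c₀`) of
`rebaseSimplePos_oneFibre_of_residual` are instances. -/
theorem rebaseSimplePos_thickBand (B m m' n₁ n₂ : ℕ) (s : KZ.IntegralRep (B + 1 + 1)) (M : Fin m' → (Fin (B + 1) → ℚ) × ℚ) (L : Fin m → (Fin B → ℚ) × ℚ) (e : Fin m → ℕ) (p : MvPolynomial (Fin B) ℚ) (ℓ₁ ℓ₂ : (Fin B → ℚ) × ℚ) (u v : (Fin (B + 1) → ℚ) × ℚ) (c₀ : ℝ) (h12 : n₁ = 0 ∨ n₂ = 0) (hbd : Bornology.IsBounded s.domain) (hdom : s.domain = SeparatePos.gDom B 1 m' M (fun _ => Sum.inr u) (fun _ => Sum.inr v)) (hint : EqOn s.integrand (RebasePos.glit B 1 p L e ℓ₁ ℓ₂ n₁ n₂ (fun _ => some 0)) s.domain) (hc₀ : 0 < c₀) (hcell : ∀ z : Fin (B + 1 + 1) → ℝ, (∀ j, 0 < SeparatePos.affF B 1 (M j) z) → 0 < SeparatePos.affF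 B 1 u z ∧ SeparatePos.affF B 1 u z + c₀ ≤ SeparatePos.affF B 1 v z) : ∃ c ∈ AddSubgroup.closure (SeparatePos.GGset B 2 1), KZ.of s - c ∈ KZ.relations :=
  RebasePos.good_thickBand L e ℓ₁ ℓ₂ n₁ n₂ s M p u v c₀ h12 hbd hdom hint hc₀ hcell

/-- **Registered part of `stub_rebaseSimplePosOne` (line `janus-bands`, v6.2): the residual
hypothesis `Hthick` of `rebaseSimplePos_oneFibre_of_residual` on base cells where the apex level
stays below `−c₀ < 0`.** One lettered fibre (letter `0`, bounds `u < v` with `u − κ = A (v − u)`,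
`A > 0`, `u > 0` and `κ ≤ −c₀` on the base cell): congruent to the subgroup generated by
`GG B 2 1` (`RebasePos.good_thick_of_apexNeg`; the band is thick, `v − u > c₀/A`). -/
theorem rebaseSimplePos_thick_of_apexNeg (B m m' n₁ n₂ : ℕ) (s : KZ.IntegralRep (B + 1 + 1)) (M : Fin m' → (Fin (B + 1) → ℚ) × ℚ) (L : Fin m → (Fin B → ℚ) × ℚ) (e : Fin m → ℕ) (p : MvPolynomial (Fin B) ℚ) (ℓ₁ ℓ₂ : (Fin B → ℚ) × ℚ) (u v κ : (Fin (B + 1) → ℚ) × ℚ) (A : ℚ) (c₀ : ℝ) (h12 : n₁ = 0 ∨ n₂ = 0) (hbd : Bornology.IsBounded s.domain) (hdom : s.domain = SeparatePos.gDom B 1 m' M (fun _ => Sum.inr u) (fun _ => Sum.inr v)) (hint : EqOn s.integrand (RebasePos.glit B 1 p L e ℓ₁ ℓ₂ n₁ n₂ (fun _ => some 0)) s.domain) (hA : u - κ = A • (v - u)) (hA0 : 0 < A) (hc₀ : 0 < c₀) (hcell : ∀ z : Fin (B + 1 + 1) → ℝ, (∀ j, 0 < SeparatePos.affF B 1 (M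 j) z) → SeparatePos.affF B 1 κ z ≤ -c₀ ∧ 0 < SeparatePos.affF B 1 u z) : ∃ c ∈ AddSubgroup.closure (SeparatePos.GGset B 2 1), KZ.of s - c ∈ KZ.relations :=
  RebasePos.good_thick_of_apexNeg L e ℓ₁ ℓ₂ n₁ n₂ s M p u v κ A c₀ h12 hbd hdom hint hA hA0 hc₀ hcell

/-- **Registered part of `stub_rebaseSimplePosOne` (line `janus-bands`, v6.2): the residual
hypothesis `Hfar` of `rebaseSimplePos_oneFibre_of_residual` on base cells where the apex level
stays above `c₀ > 0`.** One lettered fibre (letter `0`, bounds `u < v` with `u − κ = A (v − u)`,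
`A > 0`, `c₀ ≤ κ` and `2κ ≤ v` on the base cell): congruent to the subgroup generated by
`GG B 2 1` (`RebasePos.good_far_of_apexPos`; the band is thick, `v − u ≥ c₀/(A + 1)`). -/
theorem rebaseSimplePos_far_of_apexPos (B m m' n₁ n₂ : ℕ) (s : KZ.IntegralRep (B + 1 + 1)) (M : Fin m' → (Fin (B + 1) → ℚ) × ℚ) (L : Fin m → (Fin B → ℚ) × ℚ) (e : Fin m → ℕ) (p : MvPolynomial (Fin B) ℚ) (ℓ₁ ℓ₂ : (Fin B → ℚ) × ℚ) (u v κ : (Fin (B + 1) → ℚ) × ℚ) (A : ℚ) (c₀ : ℝ) (h12 : n₁ = 0 ∨ n₂ = 0) (hbd : Bornology.IsBounded s.domain) (hdom : s.domain = SeparatePos.gDom B 1 m' M (fun _ => Sum.inr u) (fun _ => Sum.inr v)) (hint : EqOn s.integrand (RebasePos.glit B 1 p L e ℓ₁ ℓ₂ n₁ n₂ (fun _ => some 0)) s.domain) (hA : u - κ = A • (v - u)) (hA0 : 0 < A) (hc₀ : 0 < c₀) (hcell : ∀ z : Fin (B + 1 + 1) → ℝ, (∀ j, 0 < SeparatePos.affF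 B 1 (M j) z) → c₀ ≤ SeparatePos.affF B 1 κ z ∧ 2 * SeparatePos.affF B 1 κ z ≤ SeparatePos.affF B 1 v z) : ∃ c ∈ AddSubgroup.closure (SeparatePos.GGset B 2 1), KZ.of s - c ∈ KZ.relations :=
  RebasePos.good_far_of_apexPos L e ℓ₁ ℓ₂ n₁ n₂ s M p u v κ A c₀ h12 hbd hdom hint hA hA0 hc₀ hcell

end Summit.KontsevichZagierPeriods.ArrangementNormalForm.JanusBands
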